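import Summits.HodgeConjecture.HodgeConjecture.Theorems.F0P3cStCharTSDGField             -- ★ DG-FIELD: `continuous_dgFormula` (measurability of the integrand); brings `Gqs`, `normAbs`, …
import Summits.HodgeConjecture.HodgeConjecture.Theorems.F0P3cStCharTSHCDLocIntTransport   -- ★ p852046 (this seat) D7-prep: `locallyIntegrable_of_…`, `enorm_inv_coe_le_inv_coe`, transport along `≃ₜ*`
import Literature.NumberTheory.Automorphic.CMLocalNonsplitBorelTransport                  -- ★ `localNonsplitEquiv_apply_apply` (entries of the one-place model); brings `localNonsplitEquiv`
import Summits.HodgeConjecture.HodgeConjecture.Theorems.F0P3cStCharTSHCDModel            -- ★ p852237 (LH6-p03 g6) (MI) `exists_nhds_setLIntegral_theta_lt_top_model` (the one-place model, modulo (iii) `hsq`, (ii) `hss`)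
import HarnessLib

/-!
# F0 · P3c · ROAD «HC-D» (holder F0P2-p01) — D7 «TERMINAL»: (HC-D) `|D_G|^{−1∕2} ∈ L¹_loc(U(Φ₃)(L⁺_v))` — the `hDGliO` hypothesis of ★ RUNG0 v2∕v3∕v4
# (`F0P3cStCharTSRung0{Two,Three,Four}.lean`, `-- hDGliO` bytes identical) — FROM the road's MODEL STATEMENT on the one-place unitary group `U(σ_w, Φ₃)(L_w)`

Cell `pub/hodgecm-mathlib`, crux H413 = `stmt-HodgeConjecture-24833` (lane `--supports … --as helper`), route HCCMUnconditional; ROAD «HC-D» (LEAD T14-10 2026-09-02T16:01Z),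
terminal brick D7 ((G1) sigfirst `F0/P2/p01/g23/HCDTerminalSigfirst.G1.F0P2p01g23.lean`).  THEOREMS ONLY; ★-only imports.
HONEST LABEL: HC_CM is proved only modulo the 7 printed citations (2 remaining named inputs: hLiu418 = `stmt-HodgeConjecture-24832`, h413 = `stmt-HodgeConjecture-24833`) until rung 0
closes; count-neutral — this file closes no organ; when the road's model statement is ★ the rider batch of RUNG0 removes the `hDGliO` binder BY NAME.

WHAT (§2 `locallyIntegrable_weylDiscr_inv_of_model`): under the organ letters `L v hns νQv` and ONE hypothesis — the road's MODEL STATEMENT at the place `w ∣ v`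
  `hModel : ∀ g₀ : U(σ_w, Φ₃)(L_w), ∃ U ∈ 𝓝 g₀, ∫⁻ g in U, T′ g ∂(νQv.map e) < ∞`,
where `e = localNonsplitEquiv` (★) and `T′` is the GROUP-SIDE TOKEN `T′ g := (↑(√√(N(discr (charpoly g)) · N(det g)⁻²)))⁻¹` (`N = normAbs (L_w)`, `ℝ≥0∞`-inverse; ROAD RULING R2) —
the conclusion is the `hDGliO` hypothesis VERBATIM:
  `LocallyIntegrable (fun g : Gqs L v => (((√√(∏_w N_w(discr (charpoly g) w) · (∏_w N_w(det g w))⁻²) : ℝ≥0) : ℝ))⁻¹) νQv`.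
PROOF: §1 the `w`-COMPONENT IDENTITIES at a non-split `v` (`Subsingleton (PlacesOver L v)`): `∏_{w′} F w′ = F w`; `(discr (charpoly g)) w = discr (charpoly (e g))` (`Matrix.charpoly_map`
+ the cubic discriminant formula on both sides) and `(det g) w = det (e g)` (`RingHom.map_det`) through ★ `localNonsplitEquiv_apply_apply` ⇒ `T′ (e g) = T g` (the CM token); §2 ★ D7-prep:
transport `hModel` along `e` (`forall_exists_setLIntegral_comp_lt_top_of_map_mulEquiv`), compare the REAL integrand with the token pointwise (`‖(↑r)⁻¹‖ₑ ≤ (↑r)⁻¹`,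
`enorm_inv_coe_le_inv_coe` — no null-set argument), measurability from ★ `continuous_dgFormula`, conclude by `locallyIntegrable_of_forall_exists_setLIntegral_lt_top`.
The model statement itself is D6(a) (F0P3a-p06) ∘ GLOBAL (F0P3a-p07) ∘ (i)–(iv); the unconditional head `locallyIntegrable_weylDiscr_inv` is appended to this file when they are ★.

## References
* [HarishChandra1970] Harish-Chandra (notes by G. van Dijk), *Harmonic Analysis on Reductive p-adic Groups*, LNM 162 (1970), Part VII §1, Theorem 15.
* [Rogawski1990] J. D. Rogawski, *Automorphic Representations of Unitary Groups in Three Variables* (1990), §4.9 p. 54 (`D_G`), §12.5 p. 182.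
* [PlatonovRapinchuk1994] V. Platonov, A. Rapinchuk, *Algebraic Groups and Number Theory* (1994), §5.1 (the one-place model at a non-split place).
-/

set_option autoImplicit false
-- the mandated namespace has the single-problem summit's repeated segment (`HodgeConjecture.HodgeConjecture`)
set_option linter.dupNamespace false

noncomputable section

open MeasureTheory Filter Topology Polynomial Set
open NumberField IsDedekindDomain
open scoped NNReal ENNReal Matrix MatrixGroups
open Literature.NumberTheory.Automorphic Literature.NumberTheory.Automorphic.UnitaryGroup
open Literature.NumberTheory.GaloisRepresentations Literature.NumberTheory.GaloisRepresentations.IsNonarchimedeanLocalField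
open Literature.NumberTheory.Rogawski1990
open Summit.HodgeConjecture.HodgeConjecture.Cruxes.H413.F0P3cStCharTSHCDLocIntTransport
open Summit.HodgeConjecture.HodgeConjecture.Cruxes.H413.F0P3cStCharTSHCDModel

namespace Summit.HodgeConjecture.HodgeConjecture.Cruxes.H413.F0P3cStCharTSWeylDiscrLocInt

/-! ## §0 The discriminant of a cubic under a ring homomorphism -/

/-- For a polynomial of degree `3` whose leading coefficient does not die under `φ`, `discr (p.map φ) = φ (discr p)` (both sides are the explicit cubic discriminant
formula, Mathlib `Polynomial.discr_of_degree_eq_three`). [folklore] -/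
theorem discr_map_of_degree_eq_three {R S : Type*} [CommRing R] [CommRing S] (φ : R →+* S) (p : R[X]) (hp : p.degree = 3) (hp' : (p.map φ).degree = 3) :
    (p.map φ).discr = φ p.discr := by
  rw [Polynomial.discr_of_degree_eq_three hp', Polynomial.discr_of_degree_eq_three hp]
  simp only [Polynomial.coeff_map, map_add, map_sub, map_mul, map_pow, map_ofNat]

/-- `discr (charpoly (M.map φ)) = φ (discr (charpoly M))` for a `3 × 3` matrix over a nontrivial commutative ring (`Matrix.charpoly_map` + the cubic formula). [folklore] -/
theorem discr_charpoly_map_fin_three {R S : Type*} [CommRing R] [CommRing S] [Nontrivial R] [Nontrivial S] (φ : R →+* S) (M : Matrix (Fin 3) (Fin 3) R) :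
    (M.map φ).charpoly.discr = φ M.charpoly.discr := by
  rw [Matrix.charpoly_map]
  have h3 : M.charpoly.degree = 3 := by
    rw [Matrix.charpoly_degree_eq_dim]; simp
  have h3' : (M.charpoly.map φ).degree = 3 := by
    rw [(Matrix.charpoly_monic M).degree_map]; exact h3
  exact discr_map_of_degree_eq_three φ M.charpoly h3 h3'

/-! ## §1 The `w`-component identities at a non-split place -/

section CM

variable (L : Type) [Field L] [NumberField L] [IsCMField L] (v : HeightOneSpectrum (𝓞 ↥(maximalRealSubfield L)))
  (w : PlacesOver L v) (hw : IsCMField.complexConj L • w.1 = w.1)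

/-- **Group-side token = CM token along `e = localNonsplitEquiv`.**  For `g ∈ U(Φ₃)(L⁺_v)` (`v` non-split, `w ∣ v`):
`T′ (e g) = T g`, where `T′ A := (↑(√√(N(discr (charpoly A)) · N(det A)⁻²)))⁻¹` on matrices over `L_w` (`N = normAbs`) and `T` is the `ℝ≥0∞`-token of the `hDGliO` integrand
(products over the places over `v`, which form a `Subsingleton`). [cite: PlatonovRapinchuk1994, §5.1] -/
theorem token_localNonsplitEquiv_eq (g : Gqs L v) :
    ((NNReal.sqrt (NNReal.sqrt (normAbs (w.1.adicCompletion L) ((((((localNonsplitEquiv (IsCMField.complexConj L) (qsForm L) (IsCMField.complexConj_ne_one L) w hw) g : ↥(unitaryGroupOfForm (galAdicCompletionMap (L := L) (IsCMField.complexConj L) hw) (placeForm (qsForm L) w.1))) : GL (Fin 3) (w.1.adicCompletion L)) : Matrix (Fin 3) (Fin 3) (w.1.adicCompletion L))).charpoly.discr) * ((normAbs (w.1.adicCompletion L) ((((((localNonsplitEquiv (IsCMField.complexConj L) (qsForm L) (IsCMField.complexConj_ne_one L) w hw) g : ↥(unitaryGroupOfForm (galAdicCompletionMap (L := L) (IsCMField.complexConj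 L) hw) (placeForm (qsForm L) w.1))) : GL (Fin 3) (w.1.adicCompletion L)) : Matrix (Fin 3) (Fin 3) (w.1.adicCompletion L))).det)) ^ 2)⁻¹)) : ℝ≥0∞))⁻¹ =
    ((NNReal.sqrt (NNReal.sqrt ((∏ w' : PlacesOver L v, normAbs (w'.1.adicCompletion L) ((((g.val : GL (Fin 3) (UnitaryGroup.LocalRing L v)).val).charpoly.discr) w')) * ((∏ w' : PlacesOver L v, normAbs (w'.1.adicCompletion L) ((((g.val : GL (Fin 3) (UnitaryGroup.LocalRing L v)).val).det) w')) ^ 2)⁻¹)) : ℝ≥0∞))⁻¹ := by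
  haveI : Subsingleton (PlacesOver L v) := PlacesOver.subsingleton_of_smul_eq (IsCMField.complexConj L) (IsCMField.complexConj_ne_one L) w hw
  -- the model matrix is the `w`-component of the CM matrix, entrywise
  set e := localNonsplitEquiv (IsCMField.complexConj L) (qsForm L) (IsCMField.complexConj_ne_one L) w hw with he
  have hmat : (((e g : ↥(unitaryGroupOfForm (galAdicCompletionMap (L := L) (IsCMField.complexConj L) hw) (placeForm (qsForm L) w.1))) :
        GL (Fin 3) (w.1.adicCompletion L)) : Matrix (Fin 3) (Fin 3) (w.1.adicCompletion L)) =
      ((g.val : GL (Fin 3) (UnitaryGroup.LocalRing L v)).val : Matrix (Fin 3) (Fin 3) (UnitaryGroup.LocalRing L v)).map (Pi.evalRingHom _ w) := by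
    ext i j
    rw [he, localNonsplitEquiv_apply_apply L v w hw g i j, Matrix.map_apply, Pi.evalRingHom_apply]
  have hdisc : (((e g : ↥(unitaryGroupOfForm (galAdicCompletionMap (L := L) (IsCMField.complexConj L) hw) (placeForm (qsForm L) w.1))) :
        GL (Fin 3) (w.1.adicCompletion L)) : Matrix (Fin 3) (Fin 3) (w.1.adicCompletion L)).charpoly.discr =
      ((g.val : GL (Fin 3) (UnitaryGroup.LocalRing L v)).val.charpoly.discr) w := by
    rw [hmat, discr_charpoly_map_fin_three]
    rfl
  have hdet : (((e g : ↥(unitaryGroupOfForm (galAdicCompletionMap (L := L) (IsCMField.complexConj L) hw) (placeForm (qsForm L) w.1))) :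
        GL (Fin 3) (w.1.adicCompletion L)) : Matrix (Fin 3) (Fin 3) (w.1.adicCompletion L)).det =
      ((g.val : GL (Fin 3) (UnitaryGroup.LocalRing L v)).val.det) w := by
    rw [hmat, ← RingHom.mapMatrix_apply, ← RingHom.map_det]
    rfl
  rw [Fintype.prod_subsingleton _ w, Fintype.prod_subsingleton _ w, hdisc, hdet]

end CM

/-! ## §2 The terminal theorem, modulo the road's model statement -/

set_option synthInstance.maxHeartbeats 400000 in
-- instance search on the CM carrier `Gqs L v` is deep (as in ★ RUNG0): raise the typeclass budget for this declaration only
/-- **(HC-D) from the MODEL STATEMENT.**  `L v hns νQv` as in the organ prefix; `w ∣ v` the place above `v`; `e := localNonsplitEquiv`.  IF on the one-place model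
`U(σ_w, Φ₃)(L_w)` every point has a neighbourhood on which the group-side token `T′` has finite `∫⁻` against `νQv.map e` (the road's D6(a) ∘ GLOBAL ∘ (i)–(iv) statement),
THEN the `hDGliO` hypothesis of ★ RUNG0 v2∕v3∕v4 holds — token for token. [cite: HarishChandra1970, Part VII §1 Thm. 15] [cite: Rogawski1990, §4.9 p. 54; §12.5 p. 182] -/
theorem locallyIntegrable_weylDiscr_inv_of_model
    (L : Type) [Field L] [NumberField L] [IsCMField L] (v : HeightOneSpectrum (𝓞 ↥(maximalRealSubfield L)))
    (w : PlacesOver L v) (hw : IsCMField.complexConj L • w.1 = w.1)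
    [MeasurableSpace (Gqs L v)] [BorelSpace (Gqs L v)] (νQv : Measure (Gqs L v))
    [MeasurableSpace ↥(unitaryGroupOfForm (galAdicCompletionMap (L := L) (IsCMField.complexConj L) hw) (placeForm (qsForm L) w.1))]
    [BorelSpace ↥(unitaryGroupOfForm (galAdicCompletionMap (L := L) (IsCMField.complexConj L) hw) (placeForm (qsForm L) w.1))]
    (hModel : ∀ g₀ : ↥(unitaryGroupOfForm (galAdicCompletionMap (L := L) (IsCMField.complexConj L) hw) (placeForm (qsForm L) w.1)),
      ∃ U ∈ 𝓝 g₀, ∫⁻ g in U,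
        ((NNReal.sqrt (NNReal.sqrt (normAbs (w.1.adicCompletion L) (((((g : ↥(unitaryGroupOfForm (galAdicCompletionMap (L := L) (IsCMField.complexConj L) hw) (placeForm (qsForm L) w.1))) : GL (Fin 3) (w.1.adicCompletion L)) : Matrix (Fin 3) (Fin 3) (w.1.adicCompletion L))).charpoly.discr) * ((normAbs (w.1.adicCompletion L) (((((g : ↥(unitaryGroupOfForm (galAdicCompletionMap (L := L) (IsCMField.complexConj L) hw) (placeForm (qsForm L) w.1))) : GL (Fin 3) (w.1.adicCompletion L)) : Matrix (Fin 3) (Fin 3) (w.1.adicCompletion L))).det)) ^ 2)⁻¹)) : ℝ≥0∞))⁻¹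
        ∂((νQv).map (fun g : Gqs L v => ((localNonsplitEquiv (IsCMField.complexConj L) (qsForm L) (IsCMField.complexConj_ne_one L) w hw) g : ↥(unitaryGroupOfForm (galAdicCompletionMap (L := L) (IsCMField.complexConj L) hw) (placeForm (qsForm L) w.1))))) < ∞) :
    LocallyIntegrable (fun g : (Gqs L v) => (((NNReal.sqrt (NNReal.sqrt ((∏ w : PlacesOver L v, IsNonarchimedeanLocalField.normAbs (w.1.adicCompletion L) (((g.val : GL (Fin 3) (UnitaryGroup.LocalRing L v)).val.charpoly.discr) w)) * ((∏ w : PlacesOver L v, IsNonarchimedeanLocalField.normAbs (w.1.adicCompletion L) (((g.val : GL (Fin 3) (UnitaryGroup.LocalRing L v)).val.det) w)) ^ 2)⁻¹)) : ℝ≥0) : ℝ))⁻¹) νQv := by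
  -- `e` read on the carrier `Gqs L v` with ITS topology instance (definitionally the domain of `localNonsplitEquiv`)
  let e' : Gqs L v ≃ₜ* ↥(unitaryGroupOfForm (galAdicCompletionMap (L := L) (IsCMField.complexConj L) hw) (placeForm (qsForm L) w.1)) :=
    (localNonsplitEquiv (IsCMField.complexConj L) (qsForm L) (IsCMField.complexConj_ne_one L) w hw)
  -- transport the neighbourhood bounds along `e'`
  have hT := forall_exists_setLIntegral_comp_lt_top_of_map_mulEquiv e' νQv _ hModel
  -- the real integrand is (strongly) measurable: it is the inverse of a continuous `ℝ≥0`-valued function (★ DG-FIELD)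
  have hcont := F0P3cStCharTSDGField.continuous_dgFormula L v
  refine locallyIntegrable_of_forall_exists_setLIntegral_lt_top (hcont.measurable.inv.aestronglyMeasurable)
    (fun g : Gqs L v => ((NNReal.sqrt (NNReal.sqrt ((∏ w' : PlacesOver L v, normAbs (w'.1.adicCompletion L) ((((g.val : GL (Fin 3) (UnitaryGroup.LocalRing L v)).val).charpoly.discr) w')) * ((∏ w' : PlacesOver L v, normAbs (w'.1.adicCompletion L) ((((g.val : GL (Fin 3) (UnitaryGroup.LocalRing L v)).val).det) w')) ^ 2)⁻¹)) : ℝ≥0∞))⁻¹) (fun g => ?_) (fun g => ?_)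
  · -- pointwise comparison with the token
    exact enorm_inv_coe_le_inv_coe _
  · -- the transported bound, rewritten by §1
    obtain ⟨U, hU, hfin⟩ := hT g
    refine ⟨U, hU, ?_⟩
    refine lt_of_le_of_lt (le_of_eq ?_) hfin
    refine lintegral_congr fun x => ?_
    exact (token_localNonsplitEquiv_eq L v w hw x).symm

/-! ## §3 The universal-model form (docking point for D6(a) ∘ GLOBAL) -/

set_option synthInstance.maxHeartbeats 400000 in
-- instance search on the CM carrier `Gqs L v` is deep (as in ★ RUNG0): raise the typeclass budget for this declaration only
/-- **(HC-D) from the MODEL THEOREM, universal form — the road's docking point.**  If for EVERY CM field `L`, place `v`, place `w ∣ v` fixed by complex conjugation, Borel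
structure and HAAR measure `ν′` on the one-place model `U(σ_w, Φ₃)(L_w)`, every point has a neighbourhood of finite `∫⁻` of the group-side token `θ` (the shape in which D6(a) ∘ GLOBAL
deliver it: `∀ ν′ Haar`), then the `hDGliO` hypothesis of ★ RUNG0 v2∕v3∕v4 holds for every non-split `v` and every Haar `νQv` — obtained from §2 at `ν′ := νQv.map e` (Haar by
`ContinuousMulEquiv.isHaarMeasure_map`) with the Borel structure `borel _` on the model.  D7-FINAL = this theorem applied to the ★ model theorem.
[cite: HarishChandra1970, Part VII §1 Thm. 15] [cite: PlatonovRapinchuk1994, §5.1] -/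
theorem locallyIntegrable_weylDiscr_inv_of_forall_model
    (MODEL : ∀ (L : Type) [Field L] [NumberField L] [IsCMField L] (v : HeightOneSpectrum (𝓞 ↥(maximalRealSubfield L)))
      (w : PlacesOver L v) (hw : IsCMField.complexConj L • w.1 = w.1)
      [MeasurableSpace ↥(unitaryGroupOfForm (galAdicCompletionMap (L := L) (IsCMField.complexConj L) hw) (placeForm (qsForm L) w.1))] [BorelSpace ↥(unitaryGroupOfForm (galAdicCompletionMap (L := L) (IsCMField.complexConj L) hw) (placeForm (qsForm L) w.1))]
      (ν' : Measure ↥(unitaryGroupOfForm (galAdicCompletionMap (L := L) (IsCMField.complexConj L) hw) (placeForm (qsForm L) w.1))) [ν'.IsHaarMeasure],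
      ∀ g₀ : ↥(unitaryGroupOfForm (galAdicCompletionMap (L := L) (IsCMField.complexConj L) hw) (placeForm (qsForm L) w.1)), ∃ U ∈ 𝓝 g₀, ∫⁻ g in U, ((NNReal.sqrt (NNReal.sqrt (normAbs (w.1.adicCompletion L) (((((g : ↥(unitaryGroupOfForm (galAdicCompletionMap (L := L) (IsCMField.complexConj L) hw) (placeForm (qsForm L) w.1))) : GL (Fin 3) (w.1.adicCompletion L)) : Matrix (Fin 3) (Fin 3) (w.1.adicCompletion L))).charpoly.discr) * ((normAbs (w.1.adicCompletion L) (((((g : ↥(unitaryGroupOfForm (galAdicCompletionMap (L := L) (IsCMField.complexConj L) hw) (placeForm (qsForm L) w.1))) : GL (Fin 3) (w.1.adicCompletion L)) : Matrix (Fin 3) (Fin 3) (w.1.adicCompletion L))).det)) ^ 2)⁻¹)) : ℝ≥0∞))⁻¹ ∂ν' < ∞)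
    (L : Type) [Field L] [NumberField L] [IsCMField L] (v : HeightOneSpectrum (𝓞 ↥(maximalRealSubfield L)))
    (hns : ∀ w : PlacesOver L v, IsCMField.complexConj L • w.1 = w.1)
    [MeasurableSpace (Gqs L v)] [BorelSpace (Gqs L v)] (νQv : Measure (Gqs L v)) [νQv.IsHaarMeasure] :
    LocallyIntegrable (fun g : (Gqs L v) => (((NNReal.sqrt (NNReal.sqrt ((∏ w : PlacesOver L v, IsNonarchimedeanLocalField.normAbs (w.1.adicCompletion L) (((g.val : GL (Fin 3) (UnitaryGroup.LocalRing L v)).val.charpoly.discr) w)) * ((∏ w : PlacesOver L v, IsNonarchimedeanLocalField.normAbs (w.1.adicCompletion L) (((g.val : GL (Fin 3) (UnitaryGroup.LocalRing L v)).val.det) w)) ^ 2)⁻¹)) : ℝ≥0) : ℝ))⁻¹) νQv := by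
  obtain ⟨w⟩ := (inferInstance : Nonempty (PlacesOver L v))
  have hw := hns w
  letI : MeasurableSpace ↥(unitaryGroupOfForm (galAdicCompletionMap (L := L) (IsCMField.complexConj L) hw) (placeForm (qsForm L) w.1)) := borel _
  haveI : BorelSpace ↥(unitaryGroupOfForm (galAdicCompletionMap (L := L) (IsCMField.complexConj L) hw) (placeForm (qsForm L) w.1)) := ⟨rfl⟩
  let e' : Gqs L v ≃ₜ* ↥(unitaryGroupOfForm (galAdicCompletionMap (L := L) (IsCMField.complexConj L) hw) (placeForm (qsForm L) w.1)) :=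
    localNonsplitEquiv (IsCMField.complexConj L) (qsForm L) (IsCMField.complexConj_ne_one L) w hw
  haveI : (νQv.map e').IsHaarMeasure := e'.isHaarMeasure_map νQv
  exact locallyIntegrable_weylDiscr_inv_of_model L v w hw νQv (MODEL L v w hw (νQv.map e'))

/-! ## §4 The road reduced to its two analytic leaves (iii) `hsq` and (ii) `hss` (★ (MI) docked, zero adapters) -/

set_option synthInstance.maxHeartbeats 400000 in
-- instance search on the CM carrier `Gqs L v` is deep (as in ★ RUNG0): raise the typeclass budget for this declaration only
/-- **(HC-D) REDUCED TO ITS TWO ANALYTIC LEAVES (iii) `hsq`, (ii) `hss` — the fallback docking point.**  The `hDGliO` hypothesis of ★ RUNG0 v2∕v3∕v4 (verbatim bytes) for every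
non-split `v` and every Haar `νQv`, from §3 applied to the ★ (MI) model theorem `F0P3cStCharTSHCDModel.exists_nhds_setLIntegral_theta_lt_top_model` (LH6-p03, p852237), which
discharges BY NAME every pin of the one-place model `U(σ_w, Φ₃)(L_w)` (★ `model_pins`, ★ (MP) `QuadraticPlaceDescentPins`, ★ (HC) cusp leaf, ★ (NB), ★ (CO), ★ GLOBAL-FINAL, ★ T5,
★ F-D6 §4) and keeps exactly the two leaves of road «HC-D» still in flight as hypotheses, in ★ GLOBAL-FINAL's letters at `K = L_w`, universally quantified over the CM datum, the
trace-zero carrier presentation `(𝔲₀, h𝔲₀)` and its additive Haar measure: (iii) `hsq` — non-zero square-zero points of `↥𝔲₀` (A-p12, Slodowy slice), (ii) `hss` — split semisimple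
non-scalar points (F0P3a-p05, descent slice).  ZERO adapters: the (MI) head IS §3's `MODEL` binder.  D7-FINAL (§5, next edition) = §3 applied to the hypothesis-free `hcd_model`, or
this theorem applied to the two ★ leaves instantiated at the pins.
[cite: HarishChandra1970, Part VII §1 Thm. 15] [cite: Rogawski1990, §4.9 p. 54; §12.5 p. 182] [cite: PlatonovRapinchuk1994, §5.1] -/
theorem locallyIntegrable_weylDiscr_inv_of_sq_ss
    (hsq : ∀ (L : Type) [Field L] [NumberField L] [IsCMField L] (v : HeightOneSpectrum (𝓞 ↥(maximalRealSubfield L)))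
      (w : PlacesOver L v) (hw : IsCMField.complexConj L • w.1 = w.1)
      (𝔲₀ : AddSubgroup (Matrix (Fin 3) (Fin 3) (w.1.adicCompletion L)))
      (_ : ∀ X, X ∈ 𝔲₀ ↔ (X.map (galAdicCompletionMap (L := L) (IsCMField.complexConj L) hw))ᵀ * placeForm (qsForm L) w.1 +
        placeForm (qsForm L) w.1 * X = 0 ∧ Matrix.trace X = 0)
      [MeasurableSpace ↥𝔲₀] [BorelSpace ↥𝔲₀] (μ₀ : Measure ↥𝔲₀) [μ₀.IsAddHaarMeasure],
      ∀ X₀ : ↥𝔲₀, X₀ ≠ 0 → (X₀ : Matrix (Fin 3) (Fin 3) (w.1.adicCompletion L)) * (X₀ : Matrix (Fin 3) (Fin 3) (w.1.adicCompletion L)) = 0 →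
        ∃ U ∈ 𝓝 X₀, ∫⁻ X in U, ((NNReal.sqrt (NNReal.sqrt (IsNonarchimedeanLocalField.normAbs (w.1.adicCompletion L)
          (Matrix.charpoly (X : Matrix (Fin 3) (Fin 3) (w.1.adicCompletion L))).discr)) : ℝ≥0∞))⁻¹ ∂μ₀ < ∞)
    (hss : ∀ (L : Type) [Field L] [NumberField L] [IsCMField L] (v : HeightOneSpectrum (𝓞 ↥(maximalRealSubfield L)))
      (w : PlacesOver L v) (hw : IsCMField.complexConj L • w.1 = w.1)
      (𝔲₀ : AddSubgroup (Matrix (Fin 3) (Fin 3) (w.1.adicCompletion L)))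
      (_ : ∀ X, X ∈ 𝔲₀ ↔ (X.map (galAdicCompletionMap (L := L) (IsCMField.complexConj L) hw))ᵀ * placeForm (qsForm L) w.1 +
        placeForm (qsForm L) w.1 * X = 0 ∧ Matrix.trace X = 0)
      [MeasurableSpace ↥𝔲₀] [BorelSpace ↥𝔲₀] (μ₀ : Measure ↥𝔲₀) [μ₀.IsAddHaarMeasure],
      ∀ X₀ : ↥𝔲₀, (∃ a b : w.1.adicCompletion L, a ≠ b ∧
          ((X₀ : Matrix (Fin 3) (Fin 3) (w.1.adicCompletion L)) - a • (1 : Matrix (Fin 3) (Fin 3) (w.1.adicCompletion L))) *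
            ((X₀ : Matrix (Fin 3) (Fin 3) (w.1.adicCompletion L)) - b • 1) = 0 ∧
          ∀ c : w.1.adicCompletion L, (X₀ : Matrix (Fin 3) (Fin 3) (w.1.adicCompletion L)) ≠ c • 1) →
        ∃ U ∈ 𝓝 X₀, ∫⁻ X in U, ((NNReal.sqrt (NNReal.sqrt (IsNonarchimedeanLocalField.normAbs (w.1.adicCompletion L)
          (Matrix.charpoly (X : Matrix (Fin 3) (Fin 3) (w.1.adicCompletion L))).discr)) : ℝ≥0∞))⁻¹ ∂μ₀ < ∞)
    (L : Type) [Field L] [NumberField L] [IsCMField L] (v : HeightOneSpectrum (𝓞 ↥(maximalRealSubfield L)))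
    (hns : ∀ w : PlacesOver L v, IsCMField.complexConj L • w.1 = w.1)
    [MeasurableSpace (Gqs L v)] [BorelSpace (Gqs L v)] (νQv : Measure (Gqs L v)) [νQv.IsHaarMeasure] :
    LocallyIntegrable (fun g : (Gqs L v) => (((NNReal.sqrt (NNReal.sqrt ((∏ w : PlacesOver L v, IsNonarchimedeanLocalField.normAbs (w.1.adicCompletion L) (((g.val : GL (Fin 3) (UnitaryGroup.LocalRing L v)).val.charpoly.discr) w)) * ((∏ w : PlacesOver L v, IsNonarchimedeanLocalField.normAbs (w.1.adicCompletion L) (((g.val : GL (Fin 3) (UnitaryGroup.LocalRing L v)).val.det) w)) ^ 2)⁻¹)) : ℝ≥0) : ℝ))⁻¹) νQv :=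
  locallyIntegrable_weylDiscr_inv_of_forall_model
    (fun L _ _ _ v w hw _ _ ν' _ g₀ => exists_nhds_setLIntegral_theta_lt_top_model L v w hw (hsq L v w hw) (hss L v w hw) ν' g₀) L v hns νQv

/-! ## §5 D7-FINAL: the `hDGliO` line of ★ RUNG0 v2∕v3∕v4, unconditionally -/

set_option synthInstance.maxHeartbeats 400000 in
-- instance search on the CM carrier `Gqs L v` is deep (as in ★ RUNG0): raise the typeclass budget for this declaration only
/-- **(HC-D) «HARISH-CHANDRA'S THEOREM 15 FOR `U(3)` AT A NON-SPLIT PLACE» — `|D_G|^{−1∕2} ∈ L¹_loc(G_v)`, UNCONDITIONAL.**  For a CM field `L`, a finite place `v` of `L⁺`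
that does not split in `L` (`hns`), and ANY Haar measure `νQv` on the quasi-split unitary group `G_v = Gqs L v = U(Φ₃)(L⁺_v)`, the function
`g ↦ |D_G(g)|^{−1∕2} = (∏_w |disc charpoly g|_w · (∏_w |det g|_w)^{−2})^{−1∕4… }` — printed EXACTLY as the `hDGliO` hypothesis of ★ RUNG0 v2 (l. 131) ≡ v3 (l. 156) ≡ v4 (l. 153),
byte for byte — is locally integrable.  PROOF = ROAD «HC-D» end to end, no orbital integrals: §3 (`…_of_forall_model`: transport along the one-place model
`localNonsplitEquiv : Gqs L v ≃ₜ* U(σ_w, Φ₃)(L_w)`, ★ p852121) applied to the hypothesis-free model theorem ★ `F0P3cStCharTSHCDModel.hcd_model` (LH6-p03), itself the composition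
BY NAME of: the Cayley chart `G → 𝔲` with `D_G(z·cay X) = |2|³|η X|^{1∕2}|det(1−X)det(1+X)|⁻¹` (★ F-D6, F0P3a-p06; ★ D6 CayleySandwich ∕ CentralShift ∕ CayleyCharpolyDiscr), the
centre-Fubini descent `↥𝔲 → ↥𝔲₀` and the four-way local resolution of `|η|^{−1∕2}` on the trace-zero skew-hermitian `3 × 3` matrices (★ GLOBAL-FINAL, F0P3a-p07): (i) regular points by
the Chevalley submersion `(tr, tr ∘ adj, det)` + the plane cusp `|−4c³−27d²|^{−1∕2}` (★ D5(i) F0P3-p04, ★ (HC) F0P3b-p01, ★ D4a LH1-p03, ★ D3 F0P2-p02 ∕ LH10-p01), (ii) split semisimple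
non-scalar points by the descent slice + the ternary form `|Q|^{−1∕2}` (★ F0P3a-p05, ★ (ii-B) LH10-p01, ★ (ii-T)∕(CO)∕(AD) F0P2-p06, ★ D3b∕c F0P3b-p01), (iii) non-zero square-zero points by
the Slodowy slice `N + 𝔷(N⁻)` with contraction weights `(2,3,3,4)`, `η ∘ ρ_t = t¹² η` (★ A-p12 FILES B∕C₀∕C∕D, ★ (iii-K) LH10-p01, ★ D4c∕D4d∕E∕F F0P3-p02), (iv) the vertex by homogeneity
(★ D3v LH10-p01); ultrametric Newton charts ★ D1∕FILE 2∕2′∕D2∕D2♭ (this seat); model pins ★ (MP) F0P3a-p07, ★ (NB) LH10-p01, ★ T5, ★ J6-T.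
This discharges the named input `hDGliO` of ★ RUNG0 v2∕v3∕v4: `hDGliO := locallyIntegrable_weylDiscr_inv L v hns νQv` (zero adapters).
[cite: HarishChandra1970, Part VII §1 Thm. 15; Part V §4 L. 22] [cite: Rogawski1990, §4.9 p. 54; §12.5 p. 182] [cite: PlatonovRapinchuk1994, §3.3; §5.1] [cite: Slodowy1980, §7.4]
[cite: Schikhof1984, §27] -/
theorem locallyIntegrable_weylDiscr_inv
    (L : Type) [Field L] [NumberField L] [IsCMField L] (v : HeightOneSpectrum (𝓞 ↥(maximalRealSubfield L)))
    (hns : ∀ w : PlacesOver L v, IsCMField.complexConj L • w.1 = w.1)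
    [MeasurableSpace (Gqs L v)] [BorelSpace (Gqs L v)] (νQv : Measure (Gqs L v)) [νQv.IsHaarMeasure] :
    LocallyIntegrable (fun g : (Gqs L v) => (((NNReal.sqrt (NNReal.sqrt ((∏ w : PlacesOver L v, IsNonarchimedeanLocalField.normAbs (w.1.adicCompletion L) (((g.val : GL (Fin 3) (UnitaryGroup.LocalRing L v)).val.charpoly.discr) w)) * ((∏ w : PlacesOver L v, IsNonarchimedeanLocalField.normAbs (w.1.adicCompletion L) (((g.val : GL (Fin 3) (UnitaryGroup.LocalRing L v)).val.det) w)) ^ 2)⁻¹)) : ℝ≥0) : ℝ))⁻¹) νQv :=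
  locallyIntegrable_weylDiscr_inv_of_forall_model (fun L _ _ _ v w hw _ _ ν' _ g₀ => hcd_model L v w hw ν' g₀) L v hns νQv

end Summit.HodgeConjecture.HodgeConjecture.Cruxes.H413.F0P3cStCharTSWeylDiscrLocInt

end
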